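import Summits.QuantumFields.YangMills.Theorems.ColdStartUniversalityLatticeLangevinChapmanKolmogorov
import HarnessLib

/-!
# Route `ColdStartUniversality` (rung input (M), crux K_A1 stmt-QuantumFields-24809): the SHIFT on the canonical path
# space — filtration measurability and freezing of an `𝓕_s`-measurable start against the shifted path

Helper file (seat `ym-line-csu-p1`, g4); tools for the splicing proof of the flow (cocycle) property (hypothesis of
`chapmanKolmogorov_of_cocycle`).  On the canonical continuous-path space with the law `Pc` of a flat Brownian motion and
the shift `θ_s p = p(s+·) − p(s)`:

* `comap_shift_natFiltration_le` / `measurable_shift_natFiltration` — `θ_s` is measurable from `𝓕_{s+i}` to `𝓕_i`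
  (the raw natural filtration of the coordinate process);
* `measure_preimage_prodMk_shift` — FREEZING: for `Y` measurable w.r.t. `𝓕_s` and a measurable `S`,
  `Pc{(Y, θ_s) ∈ S} = ∫ Pc{q | (y, q) ∈ S} dlaw(Y)(y)` (independence of `θ_s` from `𝓕_s`, `law(θ_s) = Pc`);
* `ae_mem_of_forall_prob_eq_one` — if every section of `S` is almost sure then `(Y, θ_s) ∈ S` a.s.;
* `tendsto_measure_comp_shift_of_forall` — convergence in probability of `f_m(y, ·)` for every frozen `y` gives
  convergence in probability of `f_m(Y, θ_s)` (dominated convergence).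

No definition, no sorry.  RECORD-rung R3 plumbing; nothing here bears on the mass gap.
-/

set_option autoImplicit false

noncomputable section

namespace Summit.QuantumFields.YangMills.Theorems.ColdStartUniversality

open MeasureTheory ProbabilityTheory Filter Topology
open scoped NNReal ENNReal BigOperators
open Literature.Probability.Process Literature.MathematicalPhysics.QuantumFieldTheory

variable {Ω : Type} [MeasurableSpace Ω] {P : Measure Ω} [IsProbabilityMeasure P] {L : ℕ} [NeZero L]
  {W : ℝ≥0 → Ω → (Edge 3 L × NoiseIdx 2 → ℝ)}

/-- The coordinate process of the canonical space is adapted to its raw natural filtration. [folklore] -/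
theorem measurable_coord_natFiltration (hW : IsFlatBrownian W P) {r t : ℝ≥0} (hrt : r ≤ t) :
    Measurable[(isFlatBrownian_canonical hW).natFiltration t]
      (fun p : {p : ℝ≥0 → (Edge 3 L × NoiseIdx 2 → ℝ) // Continuous p ∧ p 0 = 0} => p.1 r) := by
  have h := (Filtration.stronglyAdapted_natural (m := inferInstance)
    (u := fun (t : ℝ≥0) (p : {p : ℝ≥0 → (Edge 3 L × NoiseIdx 2 → ℝ) // Continuous p ∧ p 0 = 0}) => p.1 t)
    (fun t => ((isFlatBrownian_canonical hW).measurable t).stronglyMeasurable) r).measurable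
  exact h.mono ((isFlatBrownian_canonical hW).natFiltration.mono hrt) le_rfl

/-- **The shift is measurable from `𝓕_{s+i}` to `𝓕_i`** (σ-algebra form): the pull-back of `𝓕_i` under
`θ_s p = p(s+·) − p(s)` is contained in `𝓕_{s+i}`. [folklore] -/
theorem comap_shift_natFiltration_le (hW : IsFlatBrownian W P) (s i : ℝ≥0) :
    MeasurableSpace.comap (fun p : {p : ℝ≥0 → (Edge 3 L × NoiseIdx 2 → ℝ) // Continuous p ∧ p 0 = 0} =>
        (⟨fun u => p.1 (s + u) - p.1 s, continuous_shiftPath_and_zero (isFlatBrownian_canonical hW) s p⟩ :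
          {p : ℝ≥0 → (Edge 3 L × NoiseIdx 2 → ℝ) // Continuous p ∧ p 0 = 0}))
      ((isFlatBrownian_canonical hW).natFiltration i) ≤ (isFlatBrownian_canonical hW).natFiltration (s + i) := by
  have hWc := isFlatBrownian_canonical hW
  change MeasurableSpace.comap _ (⨆ j ≤ i, MeasurableSpace.comap
      (fun (p : {p : ℝ≥0 → (Edge 3 L × NoiseIdx 2 → ℝ) // Continuous p ∧ p 0 = 0}) => p.1 j) inferInstance) ≤ _
  rw [MeasurableSpace.comap_iSup]
  refine iSup_le fun j => ?_
  rw [MeasurableSpace.comap_iSup]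
  refine iSup_le fun hj => ?_
  rw [MeasurableSpace.comap_comp]
  -- `p ↦ p(s+j) − p(s)` is `𝓕_{s+i}`-measurable
  have h1 : Measurable[hWc.natFiltration (s + i)]
      (fun p : {p : ℝ≥0 → (Edge 3 L × NoiseIdx 2 → ℝ) // Continuous p ∧ p 0 = 0} => (p.1 (s + j), p.1 s)) :=
    (measurable_coord_natFiltration hW (r := s + j) (t := s + i) (add_le_add le_rfl hj)).prodMk
      (measurable_coord_natFiltration hW (r := s) (t := s + i) (le_self_add (a := s) (b := i)))
  have h2 : Measurable (fun v : (Edge 3 L × NoiseIdx 2 → ℝ) × (Edge 3 L × NoiseIdx 2 → ℝ) => v.1 - v.2) :=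
    (continuous_fst.sub continuous_snd).measurable
  have h3 := h2.comp h1
  exact measurable_iff_comap_le.1 h3

/-- **The shift is measurable from `𝓕_{s+i}` to `𝓕_i`** (function form). [folklore] -/
theorem measurable_shift_natFiltration (hW : IsFlatBrownian W P) (s i : ℝ≥0) :
    @Measurable _ _ ((isFlatBrownian_canonical hW).natFiltration (s + i)) ((isFlatBrownian_canonical hW).natFiltration i)
      (fun p : {p : ℝ≥0 → (Edge 3 L × NoiseIdx 2 → ℝ) // Continuous p ∧ p 0 = 0} =>
        (⟨fun u => p.1 (s + u) - p.1 s, continuous_shiftPath_and_zero (isFlatBrownian_canonical hW) s p⟩ :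
          {p : ℝ≥0 → (Edge 3 L × NoiseIdx 2 → ℝ) // Continuous p ∧ p 0 = 0})) :=
  measurable_iff_comap_le.2 (comap_shift_natFiltration_le hW s i)

/-- The shift is measurable (ambient σ-algebras). [folklore] -/
theorem measurable_shift (hW : IsFlatBrownian W P) (s : ℝ≥0) :
    Measurable (fun p : {p : ℝ≥0 → (Edge 3 L × NoiseIdx 2 → ℝ) // Continuous p ∧ p 0 = 0} =>
        (⟨fun u => p.1 (s + u) - p.1 s, continuous_shiftPath_and_zero (isFlatBrownian_canonical hW) s p⟩ :
          {p : ℝ≥0 → (Edge 3 L × NoiseIdx 2 → ℝ) // Continuous p ∧ p 0 = 0})) :=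
  (measurable_pi_lambda _ fun u => ((isFlatBrownian_shift (isFlatBrownian_canonical hW) s).measurable u)).subtype_mk

/-- **Freezing an `𝓕_s`-measurable start against the shifted path**: for `Y` measurable w.r.t. `𝓕_s` and a measurable
`S`, `Pc{p | (Y p, θ_s p) ∈ S} = ∫ Pc{q | (y, q) ∈ S} dlaw(Y)(y)` (independence of the shifted path from the past,
`indepFun_shiftPath_of_measurable`, and its canonical law, `map_shiftPath_eq`). [cite: Legall2016, Ch. 2 (simple Markov property)] -/
theorem measure_preimage_prodMk_shift (hW : IsFlatBrownian W P) (s : ℝ≥0)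
    {X : Type*} [MeasurableSpace X] {Y : {p : ℝ≥0 → (Edge 3 L × NoiseIdx 2 → ℝ) // Continuous p ∧ p 0 = 0} → X}
    (hY : Measurable[(isFlatBrownian_canonical hW).natFiltration s] Y)
    {S : Set (X × {p : ℝ≥0 → (Edge 3 L × NoiseIdx 2 → ℝ) // Continuous p ∧ p 0 = 0})} (hS : MeasurableSet S) :
    (P.map (fun ω => (⟨fun t => W t ω, continuous_path_and_zero hW ω⟩ :
        {p : ℝ≥0 → (Edge 3 L × NoiseIdx 2 → ℝ) // Continuous p ∧ p 0 = 0})))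
      {p | (Y p, (⟨fun u => p.1 (s + u) - p.1 s, continuous_shiftPath_and_zero (isFlatBrownian_canonical hW) s p⟩ :
          {p : ℝ≥0 → (Edge 3 L × NoiseIdx 2 → ℝ) // Continuous p ∧ p 0 = 0})) ∈ S} =
      ∫⁻ y, (P.map (fun ω => (⟨fun t => W t ω, continuous_path_and_zero hW ω⟩ :
          {p : ℝ≥0 → (Edge 3 L × NoiseIdx 2 → ℝ) // Continuous p ∧ p 0 = 0}))) (Prod.mk y ⁻¹' S)
        ∂((P.map (fun ω => (⟨fun t => W t ω, continuous_path_and_zero hW ω⟩ :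
          {p : ℝ≥0 → (Edge 3 L × NoiseIdx 2 → ℝ) // Continuous p ∧ p 0 = 0}))).map Y) := by
  set Pc := P.map (fun ω => (⟨fun t => W t ω, continuous_path_and_zero hW ω⟩ :
      {p : ℝ≥0 → (Edge 3 L × NoiseIdx 2 → ℝ) // Continuous p ∧ p 0 = 0})) with hPc
  haveI : IsProbabilityMeasure Pc := Measure.isProbabilityMeasure_map (measurable_pathMap hW).aemeasurable
  have hWc := isFlatBrownian_canonical hW
  have hθm := measurable_shift hW s
  have hYm : Measurable Y := hY.mono (hWc.natFiltration.le s) le_rfl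
  have hind := indepFun_shiftPath_of_measurable hWc s hY
  have hprod := (indepFun_iff_map_prod_eq_prod_map_map hYm.aemeasurable hθm.aemeasurable).1 hind
  have hθlaw : Pc.map (fun p : {p : ℝ≥0 → (Edge 3 L × NoiseIdx 2 → ℝ) // Continuous p ∧ p 0 = 0} =>
      (⟨fun u => p.1 (s + u) - p.1 s, continuous_shiftPath_and_zero hWc s p⟩ :
        {p : ℝ≥0 → (Edge 3 L × NoiseIdx 2 → ℝ) // Continuous p ∧ p 0 = 0})) = Pc := by
    rw [map_shiftPath_eq hWc s]
    have hid : (fun p : {p : ℝ≥0 → (Edge 3 L × NoiseIdx 2 → ℝ) // Continuous p ∧ p 0 = 0} =>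
        (⟨fun t => p.1 t, continuous_path_and_zero hWc p⟩ :
          {p : ℝ≥0 → (Edge 3 L × NoiseIdx 2 → ℝ) // Continuous p ∧ p 0 = 0})) = id := by
      funext p
      exact Subtype.ext rfl
    rw [hid, Measure.map_id]
  haveI : SFinite Pc := inferInstance
  calc Pc {p | (Y p, (⟨fun u => p.1 (s + u) - p.1 s, continuous_shiftPath_and_zero hWc s p⟩ :
          {p : ℝ≥0 → (Edge 3 L × NoiseIdx 2 → ℝ) // Continuous p ∧ p 0 = 0})) ∈ S}
      = (Pc.map fun p => (Y p, (⟨fun u => p.1 (s + u) - p.1 s, continuous_shiftPath_and_zero hWc s p⟩ :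
          {p : ℝ≥0 → (Edge 3 L × NoiseIdx 2 → ℝ) // Continuous p ∧ p 0 = 0}))) S := by
        rw [Measure.map_apply (hYm.prodMk hθm) hS]
        rfl
    _ = ((Pc.map Y).prod Pc) S := by rw [hprod, hθlaw]
    _ = ∫⁻ y, Pc (Prod.mk y ⁻¹' S) ∂(Pc.map Y) := Measure.prod_apply hS

/-- **Almost sure sections freeze to an almost sure event**: if every section `{q | (y, q) ∈ S}` has probability one,
then `(Y p, θ_s p) ∈ S` for `Pc`-a.e. `p`. [folklore] -/
theorem ae_mem_of_forall_prob_eq_one (hW : IsFlatBrownian W P) (s : ℝ≥0)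
    {X : Type*} [MeasurableSpace X] {Y : {p : ℝ≥0 → (Edge 3 L × NoiseIdx 2 → ℝ) // Continuous p ∧ p 0 = 0} → X}
    (hY : Measurable[(isFlatBrownian_canonical hW).natFiltration s] Y)
    {S : Set (X × {p : ℝ≥0 → (Edge 3 L × NoiseIdx 2 → ℝ) // Continuous p ∧ p 0 = 0})} (hS : MeasurableSet S)
    (hfull : ∀ y, (P.map (fun ω => (⟨fun t => W t ω, continuous_path_and_zero hW ω⟩ :
        {p : ℝ≥0 → (Edge 3 L × NoiseIdx 2 → ℝ) // Continuous p ∧ p 0 = 0}))) (Prod.mk y ⁻¹' S) = 1) :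
    ∀ᵐ p ∂(P.map (fun ω => (⟨fun t => W t ω, continuous_path_and_zero hW ω⟩ :
        {p : ℝ≥0 → (Edge 3 L × NoiseIdx 2 → ℝ) // Continuous p ∧ p 0 = 0}))),
      (Y p, (⟨fun u => p.1 (s + u) - p.1 s, continuous_shiftPath_and_zero (isFlatBrownian_canonical hW) s p⟩ :
          {p : ℝ≥0 → (Edge 3 L × NoiseIdx 2 → ℝ) // Continuous p ∧ p 0 = 0})) ∈ S := by
  set Pc := P.map (fun ω => (⟨fun t => W t ω, continuous_path_and_zero hW ω⟩ :
      {p : ℝ≥0 → (Edge 3 L × NoiseIdx 2 → ℝ) // Continuous p ∧ p 0 = 0})) with hPc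
  haveI : IsProbabilityMeasure Pc := Measure.isProbabilityMeasure_map (measurable_pathMap hW).aemeasurable
  have hWc := isFlatBrownian_canonical hW
  have hYm : Measurable Y := hY.mono (hWc.natFiltration.le s) le_rfl
  have hmeas : MeasurableSet {p | (Y p, (⟨fun u => p.1 (s + u) - p.1 s, continuous_shiftPath_and_zero hWc s p⟩ :
      {p : ℝ≥0 → (Edge 3 L × NoiseIdx 2 → ℝ) // Continuous p ∧ p 0 = 0})) ∈ S} :=
    (hYm.prodMk (measurable_shift hW s)) hS
  have h1 : Pc {p | (Y p, (⟨fun u => p.1 (s + u) - p.1 s, continuous_shiftPath_and_zero hWc s p⟩ :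
      {p : ℝ≥0 → (Edge 3 L × NoiseIdx 2 → ℝ) // Continuous p ∧ p 0 = 0})) ∈ S} = 1 := by
    rw [hPc, measure_preimage_prodMk_shift hW s hY hS]
    have hone : (fun y => (P.map (fun ω => (⟨fun t => W t ω, continuous_path_and_zero hW ω⟩ :
        {p : ℝ≥0 → (Edge 3 L × NoiseIdx 2 → ℝ) // Continuous p ∧ p 0 = 0}))) (Prod.mk y ⁻¹' S)) = fun _ => 1 :=
      funext hfull
    rw [hone, lintegral_const, one_mul, ← hPc, Measure.map_apply hYm MeasurableSet.univ, Set.preimage_univ,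
      measure_univ]
  rw [← prob_compl_eq_zero_iff hmeas] at h1
  exact ae_iff.2 h1

/-- **Convergence in probability freezes**: if for every frozen start `y` the random variables `f m (y, ·)` tend to `0`
in `Pc`-probability, then `f m (Y p, θ_s p)` tends to `0` in `Pc`-probability (freezing + dominated convergence).
[folklore] -/
theorem tendsto_measure_comp_shift_of_forall (hW : IsFlatBrownian W P) (s : ℝ≥0)
    {X : Type*} [MeasurableSpace X] {Y : {p : ℝ≥0 → (Edge 3 L × NoiseIdx 2 → ℝ) // Continuous p ∧ p 0 = 0} → X}
    (hY : Measurable[(isFlatBrownian_canonical hW).natFiltration s] Y)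
    {f : ℕ → X × {p : ℝ≥0 → (Edge 3 L × NoiseIdx 2 → ℝ) // Continuous p ∧ p 0 = 0} → ℝ} (hf : ∀ m, Measurable (f m))
    {ε : ℝ}
    (hlim : ∀ y, Tendsto (fun m => (P.map (fun ω => (⟨fun t => W t ω, continuous_path_and_zero hW ω⟩ :
        {p : ℝ≥0 → (Edge 3 L × NoiseIdx 2 → ℝ) // Continuous p ∧ p 0 = 0}))) {q | ε ≤ |f m (y, q)|}) atTop (𝓝 0)) :
    Tendsto (fun m => (P.map (fun ω => (⟨fun t => W t ω, continuous_path_and_zero hW ω⟩ :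
        {p : ℝ≥0 → (Edge 3 L × NoiseIdx 2 → ℝ) // Continuous p ∧ p 0 = 0})))
      {p | ε ≤ |f m (Y p, (⟨fun u => p.1 (s + u) - p.1 s,
          continuous_shiftPath_and_zero (isFlatBrownian_canonical hW) s p⟩ :
          {p : ℝ≥0 → (Edge 3 L × NoiseIdx 2 → ℝ) // Continuous p ∧ p 0 = 0}))|}) atTop (𝓝 0) := by
  set Pc := P.map (fun ω => (⟨fun t => W t ω, continuous_path_and_zero hW ω⟩ :
      {p : ℝ≥0 → (Edge 3 L × NoiseIdx 2 → ℝ) // Continuous p ∧ p 0 = 0})) with hPc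
  haveI : IsProbabilityMeasure Pc := Measure.isProbabilityMeasure_map (measurable_pathMap hW).aemeasurable
  have hYm : Measurable Y := hY.mono ((isFlatBrownian_canonical hW).natFiltration.le s) le_rfl
  haveI : IsProbabilityMeasure (Pc.map Y) := Measure.isProbabilityMeasure_map hYm.aemeasurable
  have hS : ∀ m, MeasurableSet {q : X × {p : ℝ≥0 → (Edge 3 L × NoiseIdx 2 → ℝ) // Continuous p ∧ p 0 = 0} |
      ε ≤ |f m q|} := fun m => measurableSet_le measurable_const (hf m).abs
  have heq : ∀ m, Pc {p | ε ≤ |f m (Y p, (⟨fun u => p.1 (s + u) - p.1 s,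
      continuous_shiftPath_and_zero (isFlatBrownian_canonical hW) s p⟩ :
        {p : ℝ≥0 → (Edge 3 L × NoiseIdx 2 → ℝ) // Continuous p ∧ p 0 = 0}))|} =
      ∫⁻ y, Pc (Prod.mk y ⁻¹' {q | ε ≤ |f m q|}) ∂(Pc.map Y) := fun m => by
    rw [hPc, ← measure_preimage_prodMk_shift hW s hY (hS m)]
    rfl
  have hlim' : ∀ y, Tendsto (fun m => Pc (Prod.mk y ⁻¹' {q | ε ≤ |f m q|})) atTop (𝓝 0) := fun y => by
    have h := hlim y
    exact h
  have hgoal : Tendsto (fun m => ∫⁻ y, Pc (Prod.mk y ⁻¹' {q | ε ≤ |f m q|}) ∂(Pc.map Y)) atTop (𝓝 0) := by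
    have h0 : (0 : ℝ≥0∞) = ∫⁻ _y, 0 ∂(Pc.map Y) := by rw [lintegral_zero]
    rw [h0]
    refine tendsto_lintegral_of_dominated_convergence (fun _ => 1) (fun m => measurable_measure_prodMk_left (hS m))
      (fun m => Eventually.of_forall fun y => prob_le_one) ?_ (Eventually.of_forall hlim')
    rw [lintegral_const, one_mul]
    exact measure_ne_top _ _
  exact hgoal.congr' (Eventually.of_forall fun m => (heq m).symm)

end Summit.QuantumFields.YangMills.Theorems.ColdStartUniversality

end
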